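import Literature.MathematicalPhysics.QuantumFieldTheory.Balaban1983to89.B9SupplySockB9P3ZdPer
import Literature.MathematicalPhysics.QuantumFieldTheory.Balaban1983to89.B8Thm2TorusSupplier

/-!
# `Balaban1983to89.B9B8KnitHolderZeroOfGlob` — the (B)-line bond junction, file 8a: ON THE TORUS THE HÖLDER BINDER OF [4] Thm 3.3 AT EXPONENT
# `β = 0` FOLLOWS FROM THE GRADIENT ENTRY OF (3.47) (constant `2B₀`) — dag-n06-b's `HolderAtIPer … (2B₀) 0 len` from `GlobAtIPer … B₀` for any record
# with periodic Green's function

statement-level skeleton of published theorems with citation tags; proofs where landed; nothing here is a claim about the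
Yang–Mills mass gap

Sub-row G-B8-T2S (unit `lit-balaban-t2s-1`, gen 6), RULING #10 road (e).  dag-n06-b's periodic socket supplier
`B9SupplySockB9P3ZdPer.sockB9P3Per_opsAllZdPer_of_binders` asks for three binders at the member: `InvAtHIPer` (Thm 3.11), `GlobAtIPer` (the three global
(3.47) entries) and `HolderAtIPer … Cβ β len` (the Hölder entry (3.45) at exponent `β`).  The 19200 consumer of this sub-row reads the (B)-line at Hölder
exponent `βH = 0` (`B8Thm2TorusB9LineReduced.hThm2_of_core_three`, `β₀ := 0`); at `β = 0` print's Hölder quotient (3.40)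
`|x − x′|^{−β}|R(U₀(Γ_{x,x′}))F(x′) − F(x)|` is `|R(U₀(Γ))F(x′) − F(x)| ≤ |F(x′)| + |F(x)|` for unitary `U₀` ([3] (56)–(57): `R(U(Γ))` is an isometry), so
the weighted Hölder supremum of `∇_{U₀}G(U₀)J` at weight `(Lʲη)^{2+0}` is at most twice the weighted supremum of `∇_{U₀}G(U₀)J` at weight `(Lʲη)²` — the
gradient clause of `GlobAtIPer`.  THIS FILE proves exactly that, for any letter record whose Green's function returns periodic fields at periodic data
(dag-n06's `gopZdHPer`: `B9Eq327GreenZdHermPer.gopZdHPer_mem_domSubHPer`), on the torus member (`Ω_j = ℤᵈ` for all `j`, `2 ≤ d`).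
Print: [4] (3.40) p. 397, (3.45), (3.47) p. 398, Thm 3.3 p. 399; [B8] (1.59) p. 86 (the Hölder line), p. 77 («Ω_j = T_η»); [3] (56)–(57) p. 27.

WHAT IS PROVED (kernel, 0 sorry, theorems only): `norm_le_sum_box_of_isPeriodic` (a periodic function on `ℤᵈ` is bounded by the sum of its norms over
one period cell), `hquot_zero_le` (`β = 0`: the quotient is `≤ ‖F x′‖ + ‖F x‖` at unitary `U₀`), ★★ `holderAtIPer_zero_of_globAtIPer`.

HONEST SCOPE.  Bookkeeping at `β = 0` only (print's Hölder line has `0 < β`; the sub-row's consumer takes `β = 0`); no estimate of [4]∕[B8] is proved;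
count-neutral; the Yang–Mills mass gap is NOT proved by any of this.  No `sorry`, no `def`, no `… : Prop` fact, no `instance`, no `notation`.  NEW file.
-/

noncomputable section

namespace Literature.MathematicalPhysics.QuantumFieldTheory.Balaban1983to89.B9B8KnitHolderZeroOfGlob

open scoped BigOperators
open B7Prop1Explicit renaming Site → LSite
open B7Prop2Explicit (unitaryUnits unitaryUnits_le_U1)
open B7Prop1Explicit (U1)
open B8Ineq132 (covDerivFwd InAk)
open B8Eq140Level (SideTouches)
open B8ScaledSupNorm (bondNorm msup weight Bdd)
open B8LeafModelZd (ZdIdx)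
open B9Eq340HolderZd (hquot AdmPair trans norm_trans hquot_nonneg)
open B9SupplySockB9P3ZdLetters (OpsZd)
open B9SupplySockB9P3ZdPer (GlobAtIPer HolderAtIPer)
open B9Eq327GreenZdHermPer (domSubHPer mem_domSubHPer_iff apply_tlift_tcls_of_isPeriodic isPeriodic_covDerivFwd isPeriodic_apply_dir)
open B8Thm2TorusSupplier (sideTouches_univ)
open T4TermwiseTorus (IsPeriodic tcls tlift)

variable {d : ℕ} {𝔸 : Type*} [CStarAlgebra 𝔸]

/-- a `P`-periodic function on `ℤᵈ` is bounded by the sum of its norms over one period cell. [cite: Balaban1985RegularSpaces, p.77 («Ω_j = T_η»), bookkeeping] -/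
theorem norm_le_sum_box_of_isPeriodic {P : ℕ} [NeZero P] {E : Type*} [SeminormedAddCommGroup E] {F : LSite d → E} (hF : IsPeriodic P F)
    (x : LSite d) : ‖F x‖ ≤ ∑ ξ : Fin d → ZMod P, ‖F (tlift ξ)‖ := by
  rw [← apply_tlift_tcls_of_isPeriodic P hF x]
  exact Finset.single_le_sum (f := fun ξ : Fin d → ZMod P => ‖F (tlift ξ)‖) (fun _ _ => norm_nonneg _) (Finset.mem_univ (tcls P x))

/-- **at `β = 0` the Hölder quotient (3.40) is at most `‖F x′‖ + ‖F x‖`** for unitary `U₀` (`R(U₀(Γ))` is an isometry).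
[cite: Balaban1985BackgroundPropagators, (3.40) p.397; Balaban1985Averaging, (56)–(57) p.27] -/
theorem hquot_zero_le [NormOneClass 𝔸] [Nontrivial 𝔸] {η : ℝ} (len : LSite d → ℝ) {U₀ : LSite d → Fin d → 𝔸ˣ} (hU₀ : ∀ x κ, U₀ x κ ∈ unitaryUnits 𝔸)
    (F : LSite d → 𝔸) (p : LSite d × LSite d) : hquot η 0 len U₀ F p ≤ ‖F p.2‖ + ‖F p.1‖ := by
  rw [B9Eq340HolderZd.hquot_def, Real.rpow_zero, div_one]
  have hU1 : ∀ y κ, U₀ y κ ∈ U1 𝔸 := fun y κ => unitaryUnits_le_U1 (hU₀ y κ)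
  calc ‖trans U₀ p.1 p.2 (F p.2) - F p.1‖ ≤ ‖trans U₀ p.1 p.2 (F p.2)‖ + ‖F p.1‖ := norm_sub_le _ _
    _ = ‖F p.2‖ + ‖F p.1‖ := by rw [norm_trans hU1]

/-- ★★ **ON THE TORUS, THE HÖLDER BINDER AT `β = 0` FOLLOWS FROM THE GRADIENT ENTRY OF (3.47)**: for a record whose Green's function is periodic at
periodic data, at a member with `Ω_j = ℤᵈ` (`2 ≤ d`, `1 ≤ L`): `GlobAtIPer P L ops aT B₀ M i m ⟹ HolderAtIPer P L ops aT (2B₀) 0 len M i m` (any `len`).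
[cite: Balaban1985BackgroundPropagators, (3.45), (3.47) p.398, (3.40) p.397, Thm 3.3 p.399; Balaban1985RegularSpaces, (1.59) p.86, p.77 («Ω_j = T_η»)] -/
theorem holderAtIPer_zero_of_globAtIPer [NormOneClass 𝔸] [Nontrivial 𝔸] {P : ℕ} [NeZero P] (hd2 : 2 ≤ d) {L : ℕ} (hL : 1 ≤ L)
    {ops : ℝ → ZdIdx d L → ℕ → OpsZd d 𝔸} {aT B₀ M : ℝ} {i : ZdIdx d L} {m : ℕ} (hΩ : ∀ j, i.Ω j = Set.univ) (hB₀ : 0 ≤ B₀)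
    (hGper : ∀ (U₀ : LSite d → Fin d → 𝔸ˣ) (J : LSite d → Fin d → 𝔸), IsPeriodic P U₀ → J ∈ domSubHPer (d := d) (𝔸 := 𝔸) P →
      IsPeriodic P ((ops M i m).Gop U₀ J))
    (len : LSite d → ℝ) (h : GlobAtIPer P L ops aT B₀ M i m) : HolderAtIPer P L ops aT (2 * B₀) 0 len M i m := by
  intro α₀ U₀ hU₀ hper hα hαT hIn J hJ
  obtain ⟨-, h1, -⟩ := h α₀ U₀ hU₀ hper hα hαT hIn J hJ
  set G := (ops M i m).Gop U₀ J with hG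
  set F : Fin d × Fin d × LSite d → 𝔸 := fun t => covDerivFwd i.η U₀ t.1 (fun z => G z t.2.1) t.2.2 with hF
  set NJ := bondNorm L m i.η (-(3 : ℝ)) i.Ω J with hNJ
  have hη := i.hη
  have hNJ0 : 0 ≤ NJ := B8ScaledSupNorm.msup_nonneg L m hη.le _ _ _
  -- the gradient family is periodic, hence bounded, hence its weighted members are below its weighted supremum
  have hGp : IsPeriodic P G := hGper U₀ J hper hJ
  have hFper : ∀ ν κ : Fin d, IsPeriodic P fun x => F (ν, κ, x) := fun ν κ =>
    isPeriodic_covDerivFwd i.η hper ν (isPeriodic_apply_dir hGp κ)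
  have hbd : ∀ t, ‖F t‖ ≤ ∑ ν : Fin d, ∑ κ : Fin d, ∑ ξ : Fin d → ZMod P, ‖F (ν, κ, tlift ξ)‖ := by
    rintro ⟨ν, κ, x⟩
    calc ‖F (ν, κ, x)‖ ≤ ∑ ξ : Fin d → ZMod P, ‖F (ν, κ, tlift ξ)‖ := norm_le_sum_box_of_isPeriodic (hFper ν κ) x
      _ ≤ ∑ κ' : Fin d, ∑ ξ : Fin d → ZMod P, ‖F (ν, κ', tlift ξ)‖ :=
          Finset.single_le_sum (f := fun κ' : Fin d => ∑ ξ : Fin d → ZMod P, ‖F (ν, κ', tlift ξ)‖)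
            (fun _ _ => Finset.sum_nonneg fun _ _ => norm_nonneg _) (Finset.mem_univ κ)
      _ ≤ ∑ ν' : Fin d, ∑ κ' : Fin d, ∑ ξ : Fin d → ZMod P, ‖F (ν', κ', tlift ξ)‖ :=
          Finset.single_le_sum (f := fun ν' : Fin d => ∑ κ' : Fin d, ∑ ξ : Fin d → ZMod P, ‖F (ν', κ', tlift ξ)‖)
            (fun _ _ => Finset.sum_nonneg fun _ _ => Finset.sum_nonneg fun _ _ => norm_nonneg _) (Finset.mem_univ ν)
  set c := ∑ ν : Fin d, ∑ κ : Fin d, ∑ ξ : Fin d → ZMod P, ‖F (ν, κ, tlift ξ)‖ with hc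
  have hLr : (1 : ℝ) ≤ L := by exact_mod_cast hL
  have hBdd : Bdd L m i.η (-(2 : ℝ)) (fun j (t : Fin d × Fin d × LSite d) => SideTouches (i.Ω j) t.2.2 t.2.1) F := by
    have e2 : (-(2 : ℝ)) = -((2 : ℕ) : ℝ) := by norm_num
    rw [e2]
    refine B8ScaledSupNorm.bdd_of_forall (c := ((L : ℝ) ^ m * i.η) ^ 2 * c) fun j hj t _ => ?_
    rw [B8ScaledSupNorm.weight_neg_natCast]
    have hw : ((L : ℝ) ^ j * i.η) ^ 2 ≤ ((L : ℝ) ^ m * i.η) ^ 2 :=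
      pow_le_pow_left₀ (by positivity) (mul_le_mul_of_nonneg_right (pow_le_pow_right₀ hLr hj) hη.le) 2
    exact mul_le_mul hw (hbd t) (norm_nonneg _) (by positivity)
  have hmem : ∀ (j : ℕ) (x : LSite d) (κ : Fin d), SideTouches (i.Ω j) x κ := fun j x κ => by
    rw [hΩ j]; exact sideTouches_univ hd2 x κ
  have hpt : ∀ j, j ≤ m → ∀ (ν κ : Fin d) (x : LSite d), weight L i.η (-(2 : ℝ)) j * ‖F (ν, κ, x)‖ ≤ B₀ * NJ := fun j hj ν κ x =>
    (B8ScaledSupNorm.weight_mul_norm_le_msup hBdd hj (i := (ν, κ, x)) (hmem j x κ)).trans h1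
  -- the Hölder supremum at `β = 0`
  refine B8ScaledSupNorm.msup_le (by positivity) fun j hj q hq => ?_
  obtain ⟨ν, κ, x, x'⟩ := q
  have hw0 : 0 ≤ weight L i.η (-(2 + 0)) j := B8ScaledSupNorm.weight_nonneg L hη.le _ j
  have hq0 : 0 ≤ hquot i.η 0 len U₀ (covDerivFwd i.η U₀ ν fun z => G z κ) (x, x') := hquot_nonneg hη.le 0 U₀ _ hq.1
  rw [Real.norm_of_nonneg hq0, show (-(2 + 0) : ℝ) = -(2 : ℝ) by norm_num]
  have hle := hquot_zero_le (η := i.η) len hU₀ (covDerivFwd i.η U₀ ν fun z => G z κ) (x, x')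
  calc weight L i.η (-(2 : ℝ)) j * hquot i.η 0 len U₀ (covDerivFwd i.η U₀ ν fun z => G z κ) (x, x')
      ≤ weight L i.η (-(2 : ℝ)) j * (‖F (ν, κ, x')‖ + ‖F (ν, κ, x)‖) :=
        mul_le_mul_of_nonneg_left hle (B8ScaledSupNorm.weight_nonneg L hη.le _ j)
    _ = weight L i.η (-(2 : ℝ)) j * ‖F (ν, κ, x')‖ + weight L i.η (-(2 : ℝ)) j * ‖F (ν, κ, x)‖ := mul_add _ _ _
    _ ≤ B₀ * NJ + B₀ * NJ := add_le_add (hpt j hj ν κ x') (hpt j hj ν κ x)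
    _ = 2 * B₀ * NJ := by ring

end Literature.MathematicalPhysics.QuantumFieldTheory.Balaban1983to89.B9B8KnitHolderZeroOfGlob
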